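import Summits.Ventures.GridStability.Models.InverterInstances
import Summits.Ventures.GridStability.Models.InverterPLLRecast
import Literature.Analysis.ODE.RouthHurwitzLowOrder

/-!
# GridStability/Models/InverterLinearisation — the Jacobians of the typed 2-state converter models at their equilibria, and their small-signal (Hurwitz / decay-rate) conditions IN CLOSED FORM

Cell `gridfusion` (LADDER-GRIDFUSION, APEX LINE; lead 02:39:27Z booked certnum RQ-013 as WAVE-1
CANDIDATE «G3-ss»: «certified damping-rate margin of the linearised droop GFM-SMIB (model-3 v1 params) /
PLLSWING over a gain box — J(p), box and printed rate to be named by model-3»; certnum-sdp-4's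
`ADAPTER-hurwitz.md` consumes an affine `J(p)`); seat gridfusion-model-3 (g4). This file is the
MODEL-SIDE input of that row, typed now so that the row can fire without waiting: the exact
Jacobian `J` of each typed 2-state reduced converter model as the Fréchet derivative of its vector
field (kernel fact `HasFDerivAt`), its characteristic polynomial `det(z·1 − J) = z² + p z + q`, and — because
these models have TWO states — the complete small-signal answer in CLOSED FORM by the tree's
Routh–Hurwitz theorem for degree 2 (lit `Literature.Analysis.ODE.RouthHurwitz.quadratic_iff`,
[cite: HairerNorsettWanner1993, §I.13 Theorem 13.4 / Exercise 1 a)]) and its shifted form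
`quadratic_re_lt_neg_iff` (every root has `Re z < −r` iff `p > 2r ∧ q − pr + r² > 0`): no kd-tree, no
SDP, valid on the whole parameter space. certnum's piecewise-Lyapunov tool is needed from 3 states up
(SRF-PLL with filter, VSM with reactive loop, droop with Q–V droop, matching control) — memo §3 lever.

WHAT IS PROVED ([folklore] calculus/algebra on the typed models; no named facts):
* §0 `quadratic_re_lt_neg_iff` — rate form of Routh–Hurwitz, degree 2.
* §1 droop GFM reduced model `InverterDroop.ReducedParams` ([cite: Qoria2020, (III-46)+(V-13)]):
  `fieldMap`, `jac δ = [[0, ω_b], [−(k_iω_c/ω_b)P_max cos δ, −ω_c]]`, `hasFDerivAt_fieldMap` (at EVERY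
  state; the Jacobian depends on `δ` only), `det_charMatrix` (`det(z·1 − J) = z² + ω_c z + k_iω_cP_max cos δ`,
  `ω_b` cancels), `hurwitz_iff` (`⟺ 0 < ω_c ∧ 0 < k_iω_cP_max cos δ`), `rate_iff`
  (`Re < −r ⟺ 2r < ω_c ∧ 0 < k_iω_cP_max cos δ − ω_c r + r²`), eigenvector form `exists_eigvec_iff_det`.
  Instance «GFM-SMIB-QoriaV4» at `δ^s`: `q = a = 233605208200/1873666673`, `p = 33`; Hurwitz;
  rate `87/20` CERTIFIED, rate `2177/500` NOT (the slow real pole lies in `(−4.354, −4.35]`; the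
  linearisation is OVERDAMPED: `p² > 4q`).
* §2 PLL generalized swing equation `InverterPLL.GenSwing` ([cite: DuEtAl2024, Eq. (1)]): `fieldMap`,
  `jacAt θ ω = [[0, 1], [−cos θ + α ω sin θ, −(α cos θ − D)]]`, `hasFDerivAt_fieldMap`, at an equilibrium
  (`ω = 0`): `det(z·1 − J) = z² + (α cos θ − D) z + cos θ`, `hurwitz_iff` (`⟺ 0 < cos θ* ∧ D < α cos θ*` —
  the local form of the state-dependent damping remark `GenSwing.energy_deriv`), `rate_iff`. Instance
  «PLLSWING-Du-I04» at `θ^s`: `p = 3985053/15841300 ≈ 0.2516`, `q = 145188/158413`; Hurwitz; rate `1/8`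
  CERTIFIED, rate `63/500 = 0.126` NOT (complex pair, `Re = −p/2 ≈ −0.1258`, lightly damped `ζ ≈ 0.13` —
  the regime certnum-sdp-4 flags as expensive for box certificates).

THREE COLUMNS. CERTIFIED (kernel): statements about the MATRIX `J` = Fréchet derivative of the typed
vector field at the typed equilibrium («small-signal» = roots of `det(z·1 − J)`; meaning for the
linearised ODE: [cite: HairerNorsettWanner1993, §I.13 Theorem 13.1]); nothing is claimed here about the
nonlinear flow (that is the -roa files' business) nor about time-varying parameters. MODELLED: droop GFM
vs infinite bus MV-6D + MV-P + MV-Ω(ω_b′ = 35500/113); PLL generalized swing eq. MV-6P + MV-P.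
VALIDATED (not used; for the row's «printed rate»): Qoria2020 / DuEtAl2024 print no eigenvalues for these
exact operating points — the G3-ss row must name its box and target rate (lead). No sentence of this file
says a converter or a grid is stable.
-/

noncomputable section

open Real Matrix

namespace Summit.Ventures.GridStability.Models

/-! ## §0 Routh–Hurwitz with a rate, degree 2 -/

/-- **Decay-rate form of Routh–Hurwitz in degree 2**: every root of `z² + pz + q` (real `p, q`) has
`Re z < −r` iff `p − 2r > 0` and `q − pr + r² > 0` (shift `z = w − r`:
`z² + pz + q = w² + (p − 2r)w + (q − pr + r²)`, then Theorem 13.4 for `n = 2`).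
[cite: HairerNorsettWanner1993, §I.13 Exercise 1 a) / Theorem 13.4] -/
theorem quadratic_re_lt_neg_iff (p q r : ℝ) :
    (∀ z : ℂ, z ^ 2 + p * z + q = 0 → z.re < -r) ↔ 0 < p - 2 * r ∧ 0 < q - p * r + r ^ 2 := by
  rw [← Literature.Analysis.ODE.RouthHurwitz.quadratic_iff]
  constructor
  · intro h w hw
    have hz := h (w - r) (by
      push_cast at hw
      linear_combination hw)
    simp only [Complex.sub_re, Complex.ofReal_re] at hz
    linarith
  · intro h z hz
    have hw := h (z + r) (by
      push_cast
      linear_combination hz)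
    simp only [Complex.add_re, Complex.ofReal_re] at hw
    linarith

/-- For a `2 × 2` real matrix: `μ ∈ ℂ` admits a (complex) eigenvector iff `det(μ·1 − J) = 0`.
[folklore] -/
theorem exists_eigvec_iff_det (J : Matrix (Fin 2) (Fin 2) ℝ) (μ : ℂ) :
    (∃ v : Fin 2 → ℂ, v ≠ 0 ∧ (J.map ((↑) : ℝ → ℂ)) *ᵥ v = μ • v)
      ↔ (μ • (1 : Matrix (Fin 2) (Fin 2) ℂ) - J.map ((↑) : ℝ → ℂ)).det = 0 := by
  rw [← Matrix.exists_mulVec_eq_zero_iff]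
  constructor
  · rintro ⟨v, hv, h⟩
    refine ⟨v, hv, ?_⟩
    rw [Matrix.sub_mulVec, Matrix.smul_mulVec, Matrix.one_mulVec, h, sub_self]
  · rintro ⟨v, hv, h⟩
    refine ⟨v, hv, ?_⟩
    rw [Matrix.sub_mulVec, Matrix.smul_mulVec, Matrix.one_mulVec, sub_eq_zero] at h
    exact h.symm

/-! ## §1 Droop grid-forming converter vs infinite bus (`InverterDroop.ReducedParams`) -/

namespace InverterDroop.ReducedParams

variable (P : ReducedParams)

/-- The reduced droop-GFM vector field as a map on `ℝ × ℝ` (state `(δ [rad], ω [pu])`, time in s):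
`(dδ, dω)` [cite: Qoria2020, eqs. (III-46), (V-13)]. MODELLED: MV-6D. -/
def fieldMap (x : ℝ × ℝ) : ℝ × ℝ := (P.dδ x.1 x.2, P.dω x.1 x.2)

/-- **The Jacobian of the reduced droop-GFM field** at a state with angle `δ` (it does not depend on
`ω`): `J(δ) = [[0, ω_b], [−(k_i ω_c/ω_b)·P_max cos δ, −ω_c]]`. [folklore] -/
def jac (δ : ℝ) : Matrix (Fin 2) (Fin 2) ℝ :=
  !![0, P.ωb; -(P.ki * P.ωc / P.ωb * (P.Pmax * cos δ)), -P.ωc]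

/-- The Jacobian as a continuous linear map on `ℝ × ℝ`. [folklore] -/
def jacCLM (δ : ℝ) : ℝ × ℝ →L[ℝ] ℝ × ℝ :=
  (P.ωb • ContinuousLinearMap.snd ℝ ℝ ℝ).prod
    ((-(P.ki * P.ωc / P.ωb * (P.Pmax * cos δ))) • ContinuousLinearMap.fst ℝ ℝ ℝ
      + (-P.ωc) • ContinuousLinearMap.snd ℝ ℝ ℝ)

/-- `jacCLM` applied: `(ω_b v₂, −(k_iω_c/ω_b)P_max cos δ · v₁ − ω_c v₂)`. [folklore] -/
@[simp] theorem jacCLM_apply (δ : ℝ) (v : ℝ × ℝ) :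
    P.jacCLM δ v = (P.ωb * v.2, -(P.ki * P.ωc / P.ωb * (P.Pmax * cos δ)) * v.1 + -P.ωc * v.2) := by
  simp [jacCLM]

/-- `jacCLM` IS the matrix `jac` (acting on coordinate vectors). [folklore] -/
theorem jacCLM_eq_mulVec (δ : ℝ) (v : ℝ × ℝ) :
    P.jacCLM δ v = ((P.jac δ *ᵥ ![v.1, v.2]) 0, (P.jac δ *ᵥ ![v.1, v.2]) 1) := by
  simp [jac, Matrix.mulVec, dotProduct, Fin.sum_univ_two]

/-- **Linearisation (kernel fact): the droop-GFM field is Fréchet differentiable at every state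
with derivative `J(δ)`** (nonzero `ω_b`, `k_i`). MODELLED: MV-6D. [folklore] -/
theorem hasFDerivAt_fieldMap (hb : P.ωb ≠ 0) (hi : P.ki ≠ 0) (x : ℝ × ℝ) :
    HasFDerivAt P.fieldMap (P.jacCLM x.1) x := by
  have h1 : HasFDerivAt (fun y : ℝ × ℝ => P.dδ y.1 y.2) (P.ωb • ContinuousLinearMap.snd ℝ ℝ ℝ) x := by
    have h := ((hasFDerivAt_snd (𝕜 := ℝ) (E := ℝ) (F := ℝ) (p := x)).sub_const P.ωe).const_mul P.ωb
    simpa [ReducedParams.dδ] using h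
  have hsin : HasFDerivAt (fun y : ℝ × ℝ => sin y.1) (cos x.1 • ContinuousLinearMap.fst ℝ ℝ ℝ) x :=
    (Real.hasDerivAt_sin x.1).comp_hasFDerivAt x (hasFDerivAt_fst (𝕜 := ℝ) (E := ℝ) (F := ℝ))
  have h2 : HasFDerivAt (fun y : ℝ × ℝ => P.dω y.1 y.2)
      ((P.ki * P.ωc / P.ωb) • ((0 : ℝ × ℝ →L[ℝ] ℝ) - P.Pmax • (cos x.1 • ContinuousLinearMap.fst ℝ ℝ ℝ)
        - (P.ωb / P.ki) • ContinuousLinearMap.snd ℝ ℝ ℝ)) x := by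
    have hin := ((hasFDerivAt_const P.pref x).sub (hsin.const_mul P.Pmax)).sub
      (((hasFDerivAt_snd (𝕜 := ℝ) (E := ℝ) (F := ℝ) (p := x)).sub_const P.ωset).const_mul (P.ωb / P.ki))
    exact hin.const_mul (P.ki * P.ωc / P.ωb)
  refine (h1.prodMk h2).congr_fderiv (ContinuousLinearMap.ext fun v => Prod.ext ?_ ?_)
  · simp [jacCLM]
  · simp [jacCLM]
    field_simp
    ring

/-- **Characteristic polynomial**: `det(z·1 − J(δ)) = z² + ω_c z + k_i ω_c P_max cos δ` (the base
frequency `ω_b` cancels: the eigenvalues of the per-unit model equal those of the swing form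
`[[0, 1], [−a, −d]]`, `a = k_iω_cP_max cos δ`, `d = ω_c`). [folklore] -/
theorem det_charMatrix (hb : P.ωb ≠ 0) (δ : ℝ) (z : ℂ) :
    (z • (1 : Matrix (Fin 2) (Fin 2) ℂ) - (P.jac δ).map ((↑) : ℝ → ℂ)).det
      = z ^ 2 + (P.ωc : ℝ) * z + (P.ki * P.ωc * P.Pmax * cos δ : ℝ) := by
  have hb' : (P.ωb : ℂ) ≠ 0 := by exact_mod_cast hb
  simp [Matrix.det_fin_two, jac]
  field_simp

/-- **Small-signal (Hurwitz) condition in closed form**: every root of `det(z·1 − J(δ))` has negative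
real part iff `ω_c > 0` and `k_i ω_c P_max cos δ > 0` (Routh–Hurwitz, `n = 2`). For positive gains
this is `cos δ > 0`, i.e. `|δ| < π/2`. [cite: HairerNorsettWanner1993, §I.13 Theorem 13.4] -/
theorem hurwitz_iff (hb : P.ωb ≠ 0) (δ : ℝ) :
    (∀ z : ℂ, (z • (1 : Matrix (Fin 2) (Fin 2) ℂ) - (P.jac δ).map ((↑) : ℝ → ℂ)).det = 0 → z.re < 0)
      ↔ 0 < P.ωc ∧ 0 < P.ki * P.ωc * P.Pmax * cos δ := by
  simp only [P.det_charMatrix hb]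
  exact Literature.Analysis.ODE.RouthHurwitz.quadratic_iff _ _

/-- **Decay-rate condition in closed form**: every root of `det(z·1 − J(δ))` has `Re z < −r` iff
`ω_c > 2r` and `k_i ω_c P_max cos δ − ω_c r + r² > 0`. [cite: HairerNorsettWanner1993, §I.13 Theorem 13.4] -/
theorem rate_iff (hb : P.ωb ≠ 0) (δ r : ℝ) :
    (∀ z : ℂ, (z • (1 : Matrix (Fin 2) (Fin 2) ℂ) - (P.jac δ).map ((↑) : ℝ → ℂ)).det = 0 → z.re < -r)
      ↔ 0 < P.ωc - 2 * r ∧ 0 < P.ki * P.ωc * P.Pmax * cos δ - P.ωc * r + r ^ 2 := by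
  simp only [P.det_charMatrix hb]
  exact quadratic_re_lt_neg_iff _ _ _

end InverterDroop.ReducedParams

/-! ### Instance «GFM-SMIB-QoriaV4» at its equilibrium `δ^s` -/

namespace InverterDroop.gfmSmibQoriaV4

/-- The characteristic polynomial of the instance's linearisation at `δ^s`:
`z² + 33 z + 233605208200/1873666673` (`p = ω_c = 33`, `q = a = k_iω_cP_max cos δ^s`, model-4's A1
datum). MODELLED: MV-6D + MV-P + MV-Ω. [folklore] -/
theorem det_charMatrix_δs (z : ℂ) :
    (z • (1 : Matrix (Fin 2) (Fin 2) ℂ) - (gfmSmibQoriaV4.jac gfmSmibQoriaV4_δs).map ((↑) : ℝ → ℂ)).det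
      = z ^ 2 + (33 : ℝ) * z + ((233605208200 : ℝ) / 1873666673 : ℝ) := by
  rw [gfmSmibQoriaV4.det_charMatrix ωb_ne_zero]
  have ha : gfmSmibQoriaV4.ki * gfmSmibQoriaV4.ωc * gfmSmibQoriaV4.Pmax * cos gfmSmibQoriaV4_δs
      = 233605208200 / 1873666673 := by
    have h := rel_a; push_cast at h; linarith
  have hc : gfmSmibQoriaV4.ωc = 33 := by norm_num [gfmSmibQoriaV4]
  rw [ha, hc]

/-- **«GFM-SMIB-QoriaV4» is small-signal Hurwitz at `δ^s`** (every root of the characteristic equation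
has negative real part). MODELLED: MV-6D + MV-P + MV-Ω. [folklore] -/
theorem hurwitz :
    ∀ z : ℂ, (z • (1 : Matrix (Fin 2) (Fin 2) ℂ)
      - (gfmSmibQoriaV4.jac gfmSmibQoriaV4_δs).map ((↑) : ℝ → ℂ)).det = 0 → z.re < 0 := by
  intro z hz
  rw [det_charMatrix_δs] at hz
  exact Literature.Analysis.ODE.RouthHurwitz.quadratic_re_neg (by norm_num) (by norm_num) z hz

/-- **Certified decay rate `87/20 = 4.35 s⁻¹`**: every root has `Re z < −87/20`
(`q − p r + r² = a − 33·(87/20) + (87/20)² > 0`, margin ≈ 0.05). MODELLED as above. [folklore] -/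
theorem rate_87_20 :
    ∀ z : ℂ, (z • (1 : Matrix (Fin 2) (Fin 2) ℂ)
      - (gfmSmibQoriaV4.jac gfmSmibQoriaV4_δs).map ((↑) : ℝ → ℂ)).det = 0 → z.re < -((87 : ℝ) / 20) := by
  intro z hz
  rw [det_charMatrix_δs] at hz
  exact (quadratic_re_lt_neg_iff _ _ _).2 ⟨by norm_num, by norm_num⟩ z hz

/-- **Rate `2177/500 = 4.354 s⁻¹` is NOT certified — it is false**: some root has `Re z ≥ −2177/500`
(the linearisation is overdamped, `33² > 4a`; its slow REAL pole lies in `(−4.354, −4.35]`).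
MODELLED as above. [folklore] -/
theorem not_rate_2177_500 :
    ¬ ∀ z : ℂ, (z • (1 : Matrix (Fin 2) (Fin 2) ℂ)
      - (gfmSmibQoriaV4.jac gfmSmibQoriaV4_δs).map ((↑) : ℝ → ℂ)).det = 0 → z.re < -((2177 : ℝ) / 500) := by
  intro h
  have h' : ∀ z : ℂ, z ^ 2 + (33 : ℝ) * z + ((233605208200 : ℝ) / 1873666673 : ℝ) = 0 →
      z.re < -((2177 : ℝ) / 500) := fun z hz => h z (by rwa [det_charMatrix_δs])
  have h2 := ((quadratic_re_lt_neg_iff _ _ _).1 h').2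
  norm_num at h2

end InverterDroop.gfmSmibQoriaV4

/-! ## §2 PLL-synchronised converter, generalized swing equation (`InverterPLL.GenSwing`) -/

namespace InverterPLL.GenSwing

variable (G : GenSwing)

/-- The generalized swing field as a map on `ℝ × ℝ` (state `(θ, ω)`, dimensionless time):
`(ω, I − sin θ − (α cos θ − D) ω)` [cite: DuEtAl2024, Eq. (1)]. MODELLED: MV-6P. -/
def fieldMap (x : ℝ × ℝ) : ℝ × ℝ := (G.dθ x.1 x.2, G.dω x.1 x.2)

/-- **The Jacobian of the generalized swing field at a state `(θ, ω)`**: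
`[[0, 1], [−cos θ + α ω sin θ, −(α cos θ − D)]]`; at an equilibrium (`ω = 0`) the lower-left entry is
`−cos θ*`. [folklore] -/
def jacAt (θ ω : ℝ) : Matrix (Fin 2) (Fin 2) ℝ :=
  !![0, 1; -cos θ + G.α * ω * sin θ, -(G.α * cos θ - G.D)]

/-- The Jacobian as a continuous linear map on `ℝ × ℝ`. [folklore] -/
def jacCLM (θ ω : ℝ) : ℝ × ℝ →L[ℝ] ℝ × ℝ :=
  (ContinuousLinearMap.snd ℝ ℝ ℝ).prod
    ((-cos θ + G.α * ω * sin θ) • ContinuousLinearMap.fst ℝ ℝ ℝ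
      + (-(G.α * cos θ - G.D)) • ContinuousLinearMap.snd ℝ ℝ ℝ)

/-- `jacCLM` applied. [folklore] -/
@[simp] theorem jacCLM_apply (θ ω : ℝ) (v : ℝ × ℝ) :
    G.jacCLM θ ω v = (v.2, (-cos θ + G.α * ω * sin θ) * v.1 + -(G.α * cos θ - G.D) * v.2) := by
  simp [jacCLM]

/-- `jacCLM` IS the matrix `jacAt`. [folklore] -/
theorem jacCLM_eq_mulVec (θ ω : ℝ) (v : ℝ × ℝ) :
    G.jacCLM θ ω v = ((G.jacAt θ ω *ᵥ ![v.1, v.2]) 0, (G.jacAt θ ω *ᵥ ![v.1, v.2]) 1) := by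
  simp [jacAt, Matrix.mulVec, dotProduct, Fin.sum_univ_two]

/-- **Linearisation (kernel fact): the generalized swing field is Fréchet differentiable at every
state with derivative `jacAt θ ω`.** MODELLED: MV-6P. [folklore] -/
theorem hasFDerivAt_fieldMap (x : ℝ × ℝ) : HasFDerivAt G.fieldMap (G.jacCLM x.1 x.2) x := by
  have h1 : HasFDerivAt (fun y : ℝ × ℝ => G.dθ y.1 y.2) (ContinuousLinearMap.snd ℝ ℝ ℝ) x := by
    simpa [GenSwing.dθ] using (hasFDerivAt_snd (𝕜 := ℝ) (E := ℝ) (F := ℝ) (p := x))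
  have hsin : HasFDerivAt (fun y : ℝ × ℝ => sin y.1) (cos x.1 • ContinuousLinearMap.fst ℝ ℝ ℝ) x :=
    (Real.hasDerivAt_sin x.1).comp_hasFDerivAt x (hasFDerivAt_fst (𝕜 := ℝ) (E := ℝ) (F := ℝ))
  have hcos : HasFDerivAt (fun y : ℝ × ℝ => cos y.1) ((-sin x.1) • ContinuousLinearMap.fst ℝ ℝ ℝ) x :=
    (Real.hasDerivAt_cos x.1).comp_hasFDerivAt x (hasFDerivAt_fst (𝕜 := ℝ) (E := ℝ) (F := ℝ))
  have hdamp : HasFDerivAt (fun y : ℝ × ℝ => (G.α * cos y.1 - G.D) * y.2)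
      ((G.α * cos x.1 - G.D) • ContinuousLinearMap.snd ℝ ℝ ℝ
        + x.2 • (G.α • ((-sin x.1) • ContinuousLinearMap.fst ℝ ℝ ℝ))) x := by
    exact ((hcos.const_mul G.α).sub_const G.D).mul (hasFDerivAt_snd (𝕜 := ℝ) (E := ℝ) (F := ℝ) (p := x))
  have h2 : HasFDerivAt (fun y : ℝ × ℝ => G.dω y.1 y.2)
      ((0 : ℝ × ℝ →L[ℝ] ℝ) - cos x.1 • ContinuousLinearMap.fst ℝ ℝ ℝ
        - ((G.α * cos x.1 - G.D) • ContinuousLinearMap.snd ℝ ℝ ℝ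
          + x.2 • (G.α • ((-sin x.1) • ContinuousLinearMap.fst ℝ ℝ ℝ)))) x := by
    exact ((hasFDerivAt_const G.I x).sub hsin).sub hdamp
  refine (h1.prodMk h2).congr_fderiv (ContinuousLinearMap.ext fun v => Prod.ext ?_ ?_)
  · simp [jacCLM]
  · simp [jacCLM]
    ring

/-- **Characteristic polynomial at an equilibrium** (`ω = 0`): `det(z·1 − J(θ, 0)) = z² + (α cos θ − D) z + cos θ`.
[folklore] -/
theorem det_charMatrix (θ : ℝ) (z : ℂ) :
    (z • (1 : Matrix (Fin 2) (Fin 2) ℂ) - (G.jacAt θ 0).map ((↑) : ℝ → ℂ)).det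
      = z ^ 2 + (G.α * cos θ - G.D : ℝ) * z + (cos θ : ℝ) := by
  simp [Matrix.det_fin_two, jacAt]
  ring

/-- **Small-signal (Hurwitz) condition in closed form** at an equilibrium `(θ*, 0)`: every root of the
characteristic equation has negative real part iff `cos θ* > 0` and `D < α cos θ*` — positive LOCAL
damping (the global caveat is `GenSwing.energy_deriv`: `α cos θ − D` changes sign for `cos θ < D/α`).
[cite: HairerNorsettWanner1993, §I.13 Theorem 13.4] -/
theorem hurwitz_iff (θ : ℝ) :
    (∀ z : ℂ, (z • (1 : Matrix (Fin 2) (Fin 2) ℂ) - (G.jacAt θ 0).map ((↑) : ℝ → ℂ)).det = 0 → z.re < 0)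
      ↔ 0 < G.α * cos θ - G.D ∧ 0 < cos θ := by
  simp only [G.det_charMatrix]
  exact Literature.Analysis.ODE.RouthHurwitz.quadratic_iff _ _

/-- **Decay-rate condition in closed form** at an equilibrium: `Re z < −r` for every root iff
`α cos θ* − D > 2r` and `cos θ* − (α cos θ* − D) r + r² > 0`. [cite: HairerNorsettWanner1993, §I.13 Theorem 13.4] -/
theorem rate_iff (θ r : ℝ) :
    (∀ z : ℂ, (z • (1 : Matrix (Fin 2) (Fin 2) ℂ) - (G.jacAt θ 0).map ((↑) : ℝ → ℂ)).det = 0 → z.re < -r)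
      ↔ 0 < G.α * cos θ - G.D - 2 * r ∧ 0 < cos θ - (G.α * cos θ - G.D) * r + r ^ 2 := by
  simp only [G.det_charMatrix]
  exact quadratic_re_lt_neg_iff _ _ _

end InverterPLL.GenSwing

/-! ### Instance «PLLSWING-Du-I04» at its equilibrium `θ^s` -/

namespace InverterPLL.GenSwing.duI04

/-- The characteristic polynomial of the instance's linearisation at `(θ^s, 0)`:
`z² + (3985053/15841300) z + 145188/158413` (`p = α c* − D`, `q = c*`). MODELLED: MV-6P + MV-P.
[folklore] -/
theorem det_charMatrix_θs (z : ℂ) :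
    (z • (1 : Matrix (Fin 2) (Fin 2) ℂ) - (duI04.jacAt duI04_θs 0).map ((↑) : ℝ → ℂ)).det
      = z ^ 2 + ((3985053 : ℝ) / 15841300 : ℝ) * z + ((145188 : ℝ) / 158413 : ℝ) := by
  rw [duI04.det_charMatrix, damping_at_equilibrium, cos_duI04_θs]

/-- **«PLLSWING-Du-I04» is small-signal Hurwitz at `θ^s`.** MODELLED: MV-6P + MV-P. [folklore] -/
theorem hurwitz :
    ∀ z : ℂ, (z • (1 : Matrix (Fin 2) (Fin 2) ℂ)
      - (duI04.jacAt duI04_θs 0).map ((↑) : ℝ → ℂ)).det = 0 → z.re < 0 := by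
  intro z hz
  rw [det_charMatrix_θs] at hz
  exact Literature.Analysis.ODE.RouthHurwitz.quadratic_re_neg (by norm_num) (by norm_num) z hz

/-- **Certified decay rate `1/8`** (dimensionless): every root has `Re z < −1/8`
(`p − 2r = 6182/3960325 > 0`: tight — the pair is complex with `Re z = −p/2 ≈ −0.1258`). [folklore] -/
theorem rate_1_8 :
    ∀ z : ℂ, (z • (1 : Matrix (Fin 2) (Fin 2) ℂ)
      - (duI04.jacAt duI04_θs 0).map ((↑) : ℝ → ℂ)).det = 0 → z.re < -((1 : ℝ) / 8) := by
  intro z hz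
  rw [det_charMatrix_θs] at hz
  exact (quadratic_re_lt_neg_iff _ _ _).2 ⟨by norm_num, by norm_num⟩ z hz

/-- **Rate `63/500 = 0.126` is NOT certified — it is false** (`p − 2r < 0`): lightly damped mode,
`ζ ≈ 0.13`. [folklore] -/
theorem not_rate_63_500 :
    ¬ ∀ z : ℂ, (z • (1 : Matrix (Fin 2) (Fin 2) ℂ)
      - (duI04.jacAt duI04_θs 0).map ((↑) : ℝ → ℂ)).det = 0 → z.re < -((63 : ℝ) / 500) := by
  intro h
  have h' : ∀ z : ℂ, z ^ 2 + ((3985053 : ℝ) / 15841300 : ℝ) * z + ((145188 : ℝ) / 158413 : ℝ) = 0 →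
      z.re < -((63 : ℝ) / 500) := fun z hz => h z (by rwa [det_charMatrix_θs])
  have h1 := ((quadratic_re_lt_neg_iff _ _ _).1 h').1
  norm_num at h1

end InverterPLL.GenSwing.duI04

end Summit.Ventures.GridStability.Models

end
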